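import Literature.Analysis.FluidPDE.LocalTypeI
import HarnessLib

/-!
# Kukavica–Rusin–Ziane 2017: the anisotropic (one-component) partial regularity criterion

Topic `Literature/Analysis/FluidPDE`; one named fact (a result in print that the tree has not
proved, `def … : Prop`, D-0014) with proved API, typed for the ns-blowup cell's kill table
(KILLSHEET §XXIV row KJ-3 «ONE-COMPONENT ε-REGULARITY … Kukavica–Rusin–Ziane JMFM 19 (2017)
Thms 2.1–2.2», a design constraint for Type-I templates; no tree decl before this file).

I. Kukavica, W. Rusin, M. Ziane, *An anisotropic partial regularity criterion for the
Navier–Stokes equations*, J. Math. Fluid Mech. 19 (2017) 123–133 = arXiv:1511.02807, §2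
(references to the arXiv version, p. 4):

Setting: `(u, p)` a suitable weak solution in an open set `D ⊆ ℝ³ × (0, ∞)` — (i)
`u ∈ L^∞_t L²_x(D) ∩ L²_t H¹_x(D)`, `p ∈ L^{3/2}(D)`; (ii) (NSE) (`ν = 1`, no force) in the weak
sense; (iii) the local energy inequality in `D` —; `Q_r(x₀, t₀) = B_r(x₀) × [t₀ - r², t₀]` "the
parabolic cylinder labeled by the top center point `(x₀, t₀)`".

> **Theorem 2.2.** For all `M, ε₀, r > 0` there exist constants `ε(M, ε₀) > 0` and
> `κ(M, ε₀) ∈ (0, 1)` with the following property: If `(u, p)` is a suitable weak solution of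
> (NSE) in `Q_r(x₀, t₀)` which satisfies `r⁻² ∫_{Q_r(x₀,t₀)} (|u|³ + |p|^{3/2}) dx dt ≤ M` and
> `r⁻² ∫_{Q_r(x₀,t₀)} |u₃|³ dx dt ≤ ε`, then
> `(κr)⁻² ∫_{Q_{κr}(x₀,t₀)} (|u|³ + |p|^{3/2}) dx dt ≤ ε₀`.

("The above theorem [Thm. 2.1: under the same two hypotheses in a neighbourhood of
`Q̄_r(x₀, t₀) ⊂ D`, `u` is regular at `(x₀, t₀)`] follows from the following stronger statement",
i.e. from Thm. 2.2 with `ε₀` the Caffarelli–Kohn–Nirenberg constant.)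

* `KukavicaRusinZiane2017.cknC3 r z u` — the scaled one-component quantity
  `r⁻² ∫∫_{Q_r(z)} |u₃|³ ∈ [0, ∞]` (third Cartesian component `u₃ = u · e₃`).
* `kukavicaRusinZiane2017_oneComponent_smallness` — **Theorem 2.2** as a named fact.
* `kukavicaRusinZiane2017_limitSystem_regular` — **Theorem 3.1** (§3 p. 6: a weak solution of the
  limit system (3.1) = (NSE) with `u₃ ≡ 0`, `u` allowed to depend on `x₃`, is regular) as a named
  fact, rendered on the open cylinder `Q_r(z)` in the same suitable class with `u₃ = 0` a.e.
  (section docstring below; typed 2026-08-28 for the scenario census, row F7h).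

## Rendering (never stronger than print)

The class "suitable weak solution in `Q_r(x₀, t₀)`" is the accepted Albritton–Barker class on
the backward parabolic ball, `IsSuitableWeakSolutionInBall r z u p` (`LocalTypeI.lean`: the accepted
local notion `IsSuitableWeakSolutionOn` on `Q_r(z) = parabolicCylinder r z` — distributional
solution with `ν = 1`, `f = 0`, local energy inequality against `C_c^∞` cut-offs — together with
the GLOBAL classes (i) on `Q_r(z)`: `esssup_t ∫_{B_r} |u|² < ∞`, `∇u ∈ L²(Q_r(z))` through a weak
spatial gradient, `p ∈ L^{3/2}(Q_r(z))`), verbatim (i)–(iii); space–time points are written time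
first, `z = (t₀, x₀)`.  `r⁻² ∫∫_{Q_r}(|u|³ + |p|^{3/2})` is the accepted `cknC r z u + cknD r z p`
(`SuitableWeak.lean`), the one-component quantity is `cknC3` below; all inequalities in `ℝ≥0∞`
with `ENNReal.ofReal` on the printed constants.  The constants `ε, κ` depend on `M, ε₀` only, as
printed (`∀ M ε₀, ∃ ε κ, ∀ r z u p`).  Not restated: Thm. 2.1 (= Thm. 2.2 composed with the CKN
ε-regularity criterion, e.g. the tree's `lemarieRieusset_epsilon_regularity`; the composition at
the top-centre point is left to consumers), Cor. 2.3 (the anisotropic Leray rate), and of §3 (the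
limit system) everything but Thm. 3.1 (Lemmas 3.2–3.4, the `ω₃` bootstrap and the quantitative
bound (3.13)).

## Mathlib / tree search

`lean search 'Kukavica|RusinZiane|1511.02807|oneComponent'`: no declaration (2026-08-26; bib key
`KukavicaRusinZiane2016`).  Reused: `IsSuitableWeakSolutionInBall` (`LocalTypeI.lean`), `cknC`,
`cknD`, `parabolicCylinder` (`SuitableWeak.lean`).  Neighbours: `seregin2014_thm14` (Seregin's
`E`-smallness criterion in the same class), `lemarieRieusset_epsilon_regularity` (CKN one-scale).

## References

* I. Kukavica, W. Rusin, M. Ziane, J. Math. Fluid Mech. 19 (2017) 123–133, arXiv:1511.02807: §2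
  (i)–(iii), Thm. 2.1, Thm. 2.2 (p. 4); §3 system (3.1), Thm. 3.1, Lemmas 3.2–3.3 (pp. 6–7).
  [`KukavicaRusinZiane2016`]
* L. Caffarelli, R. Kohn, L. Nirenberg, CPAM 35 (1982), Prop. 1 (the `ε₀`). [`CaffarelliKohnNirenberg1982`]
-/

noncomputable section

open MeasureTheory Set Function Filter Topology TopologicalSpace Metric
open scoped NNReal ENNReal

namespace Literature.Analysis.FluidPDE

/-- Local notation for physical space `ℝ³ = EuclideanSpace ℝ (Fin 3)`. -/
local notation "ℝ³" => EuclideanSpace ℝ (Fin 3)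

namespace KukavicaRusinZiane2017

/-- The scaled one-component cubic quantity `r⁻² ∫∫_{Q_r(z)} |u₃|³ ∈ [0, ∞]` of
Kukavica–Rusin–Ziane 2017, Thm. 2.2 (third Cartesian component `u₃`; the accepted `cknC` with `|u|`
replaced by `|u₃|`).  Intended for `r > 0`. [cite: KukavicaRusinZiane2016, Thm. 2.2 (the quantity r⁻²∫|u₃|³)] -/
def cknC3 (r : ℝ) (z : ℝ × ℝ³) (u : ℝ → ℝ³ → ℝ³) : ℝ≥0∞ :=
  (ENNReal.ofReal r ^ 2)⁻¹ * ∫⁻ q in parabolicCylinder r z, ‖u q.1 q.2 2‖ₑ ^ (3 : ℕ)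

/-- `r⁻² ∫∫ |u₃|³ ≤ r⁻² ∫∫ |u|³`: the one-component quantity is dominated by the accepted `cknC`
(`|u₃| ≤ |u|`). [cite: KukavicaRusinZiane2016, Thm. 2.2] -/
theorem cknC3_le_cknC (r : ℝ) (z : ℝ × ℝ³) (u : ℝ → ℝ³ → ℝ³) : cknC3 r z u ≤ cknC r z u := by
  unfold cknC3 cknC
  gcongr with q
  have h : ‖u q.1 q.2 2‖ ≤ ‖u q.1 q.2‖ := by
    simpa [Real.norm_eq_abs] using PiLp.norm_apply_le (u q.1 q.2) 2
  rw [← ofReal_norm, ← ofReal_norm]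
  exact ENNReal.ofReal_le_ofReal h

end KukavicaRusinZiane2017

open KukavicaRusinZiane2017

/-! ### The named fact -/

/-- **Kukavica–Rusin–Ziane 2017, Theorem 2.2 (one small component forces CKN-smallness at a
smaller scale).**  "For all `M, ε₀, r > 0` there exist constants `ε(M, ε₀) > 0` and
`κ(M, ε₀) ∈ (0, 1)` with the following property: If `(u, p)` is a suitable weak solution of (NSE)
in `Q_r(x₀, t₀)` which satisfies `r⁻² ∫_{Q_r(x₀,t₀)} (|u|³ + |p|^{3/2}) ≤ M` and
`r⁻² ∫_{Q_r(x₀,t₀)} |u₃|³ ≤ ε`, then `(κr)⁻² ∫_{Q_{κr}(x₀,t₀)} (|u|³ + |p|^{3/2}) ≤ ε₀`" (`ν = 1`,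
no force).  Rendered (module docstring) in the Albritton–Barker class on the backward ball with the
accepted `cknC`, `cknD` and `cknC3`. [cite: KukavicaRusinZiane2016, Thm. 2.2 (arXiv:1511.02807 §2 p. 4)] -/
def kukavicaRusinZiane2017_oneComponent_smallness : Prop :=
  ∀ (M ε₀ : ℝ), 0 < M → 0 < ε₀ → ∃ ε κ : ℝ, 0 < ε ∧ 0 < κ ∧ κ < 1 ∧
    ∀ (r : ℝ) (z : ℝ × ℝ³) (u : ℝ → ℝ³ → ℝ³) (p : ℝ → ℝ³ → ℝ), 0 < r →
      IsSuitableWeakSolutionInBall r z u p →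
      cknC r z u + cknD r z p ≤ ENNReal.ofReal M →
      cknC3 r z u ≤ ENNReal.ofReal ε →
      cknC (κ * r) z u + cknD (κ * r) z p ≤ ENNReal.ofReal ε₀

/-! ### API -/

namespace kukavicaRusinZiane2017_oneComponent_smallness

/-- Theorem 2.2 applied: the constants for given `M, ε₀`. [cite: KukavicaRusinZiane2016, Thm. 2.2] -/
theorem exists_constants (h : kukavicaRusinZiane2017_oneComponent_smallness) {M ε₀ : ℝ}
    (hM : 0 < M) (hε₀ : 0 < ε₀) :
    ∃ ε κ : ℝ, 0 < ε ∧ 0 < κ ∧ κ < 1 ∧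
      ∀ (r : ℝ) (z : ℝ × ℝ³) (u : ℝ → ℝ³ → ℝ³) (p : ℝ → ℝ³ → ℝ), 0 < r →
        IsSuitableWeakSolutionInBall r z u p →
        cknC r z u + cknD r z p ≤ ENNReal.ofReal M →
        cknC3 r z u ≤ ENNReal.ofReal ε →
        cknC (κ * r) z u + cknD (κ * r) z p ≤ ENNReal.ofReal ε₀ :=
  h M ε₀ hM hε₀

/-- **Contrapositive, the kill-table form (KJ-3): if the CKN quantity stays above `ε₀` at the
scale `κ(M, ε₀) r` while the full scale-invariant size at scale `r` is at most `M`, then the third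
component alone carries `r⁻² ∫∫_{Q_r} |u₃|³ > ε(M, ε₀)`** ("at a singular point, at every scale
where the full scale-invariant size is `≤ M`, each fixed Cartesian component carries more than
`ε(M)`" — for `e₃`; other components by rotation, not formalised). [cite: KukavicaRusinZiane2016, Thm. 2.2 and Thm. 2.1] -/
theorem cknC3_gt_of_not_small (h : kukavicaRusinZiane2017_oneComponent_smallness) {M ε₀ : ℝ}
    (hM : 0 < M) (hε₀ : 0 < ε₀) :
    ∃ ε κ : ℝ, 0 < ε ∧ 0 < κ ∧ κ < 1 ∧
      ∀ (r : ℝ) (z : ℝ × ℝ³) (u : ℝ → ℝ³ → ℝ³) (p : ℝ → ℝ³ → ℝ), 0 < r →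
        IsSuitableWeakSolutionInBall r z u p →
        cknC r z u + cknD r z p ≤ ENNReal.ofReal M →
        ENNReal.ofReal ε₀ < cknC (κ * r) z u + cknD (κ * r) z p →
        ENNReal.ofReal ε < cknC3 r z u := by
  obtain ⟨ε, κ, hε, hκ, hκ1, hmain⟩ := h M ε₀ hM hε₀
  refine ⟨ε, κ, hε, hκ, hκ1, fun r z u p hr hsw hM' hbig => ?_⟩
  by_contra hle
  exact (lt_irrefl _) (hbig.trans_le (hmain r z u p hr hsw hM' (not_lt.mp hle)))

end kukavicaRusinZiane2017_oneComponent_smallness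

/-! ### Theorem 3.1 — the limit system (`u₃ ≡ 0`) has no singular points

§3 of the paper (arXiv p. 6): "Let `D ⊂ ℝ³ × (0,∞)` be a domain. Consider the system
`∂ₜuᵢ − Δuᵢ + Σ_{j=1}^{2} uⱼ ∂ⱼuᵢ + ∂ᵢp = 0` in `D`, `i = 1, 2`; `∂₃p = 0` in `D`;
`∂₁u₁ + ∂₂u₂ = 0` in `D` (3.1), where `u(x₁,x₂,x₃,t)` and `p(x₁,x₂,x₃,t)` are unknown. Note
that the system (3.1) stems from the Navier–Stokes equations by setting `u₃ = 0`. … (The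
definition for a regular/singular point is the same as the one for the Navier–Stokes system.)"
— and §1 (p. 3): "a point is regular if there exists a neighborhood in which `u` is bounded (and
thus Hölder continuous); otherwise, the point is called singular."  The velocity is allowed to
depend on `x₃`; only its VALUE is constrained (`u · e₃ ≡ 0`), which distinguishes this cell from
the `2½`-dimensional (`x₃`-independent) setting.

Rendering (never stronger than print).  Special case `D = Q_r(z)`, the open backward parabolic
cylinder (interior regularity is local, so this covers a general open `D` point by point —
`TODO(general form)` below), with `(u, p)` in the SUITABLE weak class §2 (i)–(iii) of the paper on
`Q_r(z)` — the accepted `IsSuitableWeakSolutionInBall r z u p`, exactly as for Thm. 2.2 above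
(time-translation as there) — and the value constraint `u₃ = 0` almost everywhere on `Q_r(z)`.
Then `((u₁, u₂), p)` is a weak solution of (3.1) in `Q_r(z)`: the third momentum equation of
(NSE) reads `∂₃p = 0`, while the first two equations, the divergence condition, the class (i) and
the local energy inequality (iii) coincide with those of (NSE) for `((u₁, u₂, 0), p)`; so the
printed hypothesis ("a weak solution of (3.1)") holds — print asks for no more than this, and the
suitable class is the one in which §4 of the paper applies Thm. 3.1 (to limits of suitable weak
solutions, Lemma 4.1) and the class of the scenario-census cell F7h.  Conclusion: every point of
the open cylinder is a regular point in the accepted sense `IsRegularPoint` (`u` essentially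
bounded on some centred cylinder `Q*_ρ(z')`, which for small `ρ` lies inside `Q_r(z)`).

Printed proof route (pp. 6–7, not formalised): for `u₃ ≡ 0` the vertical vorticity
`ω₃ = ∂₁u₂ − ∂₂u₁` solves the transport–diffusion equation `∂ₜω₃ − Δω₃ + Σ_{j≤2} uⱼ ∂ⱼω₃ = 0`
(3.3) WITHOUT a stretching term ⇒ Moser iteration `|ω₃|^{q/2} ∈ L^∞_t L²_x ∩ L²_t H¹_x (Q_ρ)` for
every `q ∈ [2, ∞)` (Lemma 3.2) ⇒ a localised Stokes system for `v = ηu − V` with a Bogovskiĭ-type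
corrector (Lemma 3.3, Galdi) ⇒ `v ∈ L^{5/2}_t L^{15}_x`, a critical Serrin class ⇒ regular.
Neighbours in print (not restated): Neustupa–Penel 2001 / Neustupa–Novotný–Penel 2002 (interior
regularity of a suitable weak solution from a Serrin-type condition on ONE velocity component —
the authors note (p. 6) that those results "are not directly applicable in the considered setting");
in tree, the classical-continuation twins `wangWuZhang2023_oneComponent_lorentzSerrin_criterion.of_ae_eq_zero`
and `chaeWolf2021_oneComponent_almostSerrin_criterion.of_ae_eq_zero` (global classical solutions
on `ℝ³ × [0,T)` with `u₃ = 0` a.e., conditional on those facts) — a different class. -/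

/-- **Kukavica–Rusin–Ziane 2017, Theorem 3.1 (the limit system `u₃ ≡ 0` is regular).**
"**Theorem 3.1.** Let `(u, p)` be a weak solution of (3.1). Then `u` is regular." — (3.1) being
the Navier–Stokes system in a space–time domain `D` with `u₃` set to `0` (so `∂₃p = 0`), `u`
allowed to depend on `x₃`, and "regular" meaning that every point of `D` has a neighbourhood in
which `u` is bounded (§1 p. 3, §3 p. 6).  Rendered (section docstring) for `D = Q_r(z)` the open
backward parabolic cylinder, `(u, p)` a suitable weak solution of the unforced system (`ν = 1`) in
`Q_r(z)` in the accepted class `IsSuitableWeakSolutionInBall` (§2 (i)–(iii) of the paper) whose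
third Cartesian component `u · e₃` vanishes almost everywhere on `Q_r(z)`: then every point of
`Q_r(z)` is a regular point (`IsRegularPoint`).  Statement only; users take
`(h : kukavicaRusinZiane2017_limitSystem_regular)`.
-- TODO(general form): an arbitrary domain `D ⊆ ℝ³ × (0, ∞)` and print's bare "weak solution of
-- (3.1)" class (energy class (i) + the equations (ii), without the local energy inequality).
[cite: KukavicaRusinZiane2016, Thm. 3.1 (arXiv:1511.02807 §3 p. 6, system (3.1); proof pp. 6–7, Lemmas 3.2–3.3, eq. (3.3))] -/
def kukavicaRusinZiane2017_limitSystem_regular : Prop :=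
  ∀ (r : ℝ) (z : ℝ × ℝ³) (u : ℝ → ℝ³ → ℝ³) (p : ℝ → ℝ³ → ℝ), 0 < r →
    IsSuitableWeakSolutionInBall r z u p →
    (∀ᵐ q ∂(volume.restrict (parabolicCylinder r z)), u q.1 q.2 2 = 0) →
    ∀ z' ∈ parabolicCylinder r z, IsRegularPoint u z'

/-! ### API -/

namespace kukavicaRusinZiane2017_limitSystem_regular

variable {r : ℝ} {z z' : ℝ × ℝ³} {u : ℝ → ℝ³ → ℝ³} {p : ℝ → ℝ³ → ℝ}

/-- Theorem 3.1 applied at one interior point of the cylinder. [cite: KukavicaRusinZiane2016, Thm. 3.1] -/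
theorem isRegularPoint (h : kukavicaRusinZiane2017_limitSystem_regular) (hr : 0 < r)
    (hsw : IsSuitableWeakSolutionInBall r z u p)
    (h₃ : ∀ᵐ q ∂(volume.restrict (parabolicCylinder r z)), u q.1 q.2 2 = 0)
    (hz' : z' ∈ parabolicCylinder r z) : IsRegularPoint u z' :=
  h r z u p hr hsw h₃ z' hz'

/-- The everywhere-pointwise form of the value constraint (`u₃ = 0` at every point of `Q_r(z)`,
the form in which typed scenario cells state it) implies the almost-everywhere form used by the
fact. [cite: KukavicaRusinZiane2016, Thm. 3.1] -/
theorem isRegularPoint_of_forall (h : kukavicaRusinZiane2017_limitSystem_regular) (hr : 0 < r)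
    (hsw : IsSuitableWeakSolutionInBall r z u p)
    (h₃ : ∀ q ∈ parabolicCylinder r z, u q.1 q.2 2 = 0)
    (hz' : z' ∈ parabolicCylinder r z) : IsRegularPoint u z' :=
  h.isRegularPoint hr hsw
    ((ae_restrict_iff' (isOpen_parabolicCylinder r z).measurableSet).2 (ae_of_all _ h₃)) hz'

/-- **No singular point in the cylinder**: under the hypotheses of the fact the accepted singular
set of `u` in `Q_r(z)` is empty ("Then `u` is regular", i.e. `𝒮(u) ∩ D = ∅`, §3 p. 6). [cite: KukavicaRusinZiane2016, Thm. 3.1 (with the singular set 𝒮(u) of §3)] -/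
theorem singularSet_eq_empty (h : kukavicaRusinZiane2017_limitSystem_regular) (hr : 0 < r)
    (hsw : IsSuitableWeakSolutionInBall r z u p)
    (h₃ : ∀ᵐ q ∂(volume.restrict (parabolicCylinder r z)), u q.1 q.2 2 = 0) :
    singularSet u (parabolicCylinder r z) = ∅ := by
  ext w
  simp only [singularSet, mem_setOf_eq, mem_empty_iff_false, iff_false, not_and, not_not]
  exact fun hw => h.isRegularPoint hr hsw h₃ hw

/-- Monotonicity in the cylinder: the conclusion at scale `r` gives the conclusion on every
smaller concentric cylinder `Q_ρ(z) ⊆ Q_r(z)`, `ρ ≤ r` (bookkeeping for consumers who shrink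
the ball; Thm. 3.1 at the points of the sub-cylinder). [cite: KukavicaRusinZiane2016, Thm. 3.1] -/
theorem isRegularPoint_of_le (h : kukavicaRusinZiane2017_limitSystem_regular) (hr : 0 < r)
    (hsw : IsSuitableWeakSolutionInBall r z u p)
    (h₃ : ∀ᵐ q ∂(volume.restrict (parabolicCylinder r z)), u q.1 q.2 2 = 0)
    {ρ : ℝ} (hρr : ρ ≤ r) (hz' : z' ∈ parabolicCylinder ρ z) : IsRegularPoint u z' := by
  refine h.isRegularPoint hr hsw h₃ ?_
  rw [mem_parabolicCylinder] at hz' ⊢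
  have hρ0 : 0 ≤ ρ := by
    by_contra hneg
    exact (lt_irrefl _) ((hz'.2.trans (not_le.mp hneg)).trans_le dist_nonneg)
  have hsq : ρ ^ 2 ≤ r ^ 2 := pow_le_pow_left₀ hρ0 hρr 2
  exact ⟨⟨by linarith [hz'.1.1], hz'.1.2⟩, hz'.2.trans_le hρr⟩

end kukavicaRusinZiane2017_limitSystem_regular

end Literature.Analysis.FluidPDE

end
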